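import Summits.CriticalPhenomena.Ising3D.Control2DReadoutWindowSpin
import Summits.CriticalPhenomena.Ising3D.Control2DL19BoxXData151
import Summits.CriticalPhenomena.Ising3D.Control2DL19BoxXRegion
import Mathlib.Tactic.NormNum
import Mathlib.Tactic.Linarith
import HarnessLib

/-!
# Readout certificate B19 over a WINDOW, spin-4 channel: `f(5.10) < f(Δ)` for EVERY `Δ ∈ [4.125, 5.06]` — the spin-4 near-zero at
`5.10 ± 0.04` is the least value of the spin-4 action over the whole window `[4.125, 5.10 + 0.04]` (cell `pub-ising3x`, seat controls-1
gen 30; KERNEL, certificate kind "readout", continuum form, spin extension — CONTROL-ONLY)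

HONEST FRAMING: lottery ticket; floor = tightest certified 3D Ising CFT bounds; no exact-solution
claim without a proof. CONTROL-ONLY (`d = 2`, `Δ_σ = 1/8`); a statement about one of our INSTRUMENTS (the kernel-certified Λ = 19
lower-edge box functional `wtboxX` on `slL19`, the typed `edgeB19` of `Control2DConjectureCF`), not about a CFT; nothing about `d = 3`.

`Control2DReadoutSpin4B19.dip4_B19` samples the spin-4 action `f(Δ) = φ[F^{1/8}_-[g_{Δ,4}]]` at `{5, 5.06, 5.10, 5.14}`.
Here `f(5.10) < f(Δ)` is certified for the CONTINUUM `Δ ∈ [33/8, 253 / 50]` by ONE Bernstein cell of the spin-4 window polynomial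
(`Control2DReadoutWindowSpin.windowCheckSpin`: cell polynomial `phatboxXs4 = cellPolyZ wtboxX slL19 19 4 79` of the landed replay's spin-4 cells
obligation, digit cut `10^576` as in its landed cells, `y = (Δ - 4)/2 ∈ [50/800, 424/800]`, readout truncation `N = 160`, room `k = 1`,
region threshold `E₀ = 48`). Near the unitarity edge `Δ = 4` (where the 2D twist-0 current `(4,0)` sits and `A2D′` starts the spin-4 blocks) the
spin-4 action has its edge near-zero within `(4, 4.06)`; the window starts at `4 + 1/8`, where `f` already exceeds `f(5.10)` by a factor
`≥ 9` for every object of the family. With `dip4_B19` (`f(5.10) < f(5.14)`): over `[4.125, 5.10 + 0.04]` the least value of the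
spin-4 action is attained only inside `(5.06, 5.14)` — the instrument's first spin-4 near-zero above the edge sits at
`δ₄(19) = 0.10 ± 0.04` above the 2D Ising level `Δ = 5` with NO lower excursion anywhere in `[4.125, 5.06]`. Zero grant compute.
No facts, standard axioms only. [cite: RattazziEtAl2008, §5.5]
-/

namespace Summit.CriticalPhenomena.Ising3D.Control2D

open Set
open Literature.MathematicalPhysics.QuantumFieldTheory.ConformalBootstrap3D

set_option maxHeartbeats 0 in
set_option maxRecDepth 200000 in
/-- The spin-4 window cell of B19: `y ∈ [50/800, 424/800]` (`Δ ∈ [4.125, 5.06]`), one Bernstein certificate decided in the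
kernel. [folklore] -/
theorem windowCheckSpin4_B19 :
    windowCheckSpin wtboxX slL19 19 4 1 79 576 160 48 (51 / 10) 800 50 374 phatboxXs4 = true := by
  decide +kernel

set_option maxRecDepth 8192 in
/-- **B19 spin-4 window readout, kernel-complete**: for `φ = taylorFunctional2D (1/2) slL19 wtboxX` (`Δ_σ = 1/8`, spin-4 channel) and
EVERY `Δ ∈ [33/8, 253 / 50]`: `f(51 / 10) < f(Δ)`. CONTROL-ONLY (d = 2). [cite: RattazziEtAl2008, §5.5] -/
theorem window4_B19 (Δ : ℝ) (h1 : (33 : ℝ) / 8 ≤ Δ) (h2 : Δ ≤ 253 / 50) :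
    taylorFunctional2D (1 / 2) slL19.toFinset (fun p => (wtboxX p : ℝ)) (crossF (1 / 8) (-1) (globalBlock (51 / 10) 4)) <
      taylorFunctional2D (1 / 2) slL19.toFinset (fun p => (wtboxX p : ℝ)) (crossF (1 / 8) (-1) (globalBlock Δ 4)) := by
  have hR := (region_of_kernelCertAuto wtboxX slL19_nodup slL19_deg 19 20 (by norm_num) (by norm_num) PregboxX_eq
      (by decide +kernel) QhatboxX_eq _ cregboxX_n0 cregJboxX (by decide) cregJboxX_ok)
  have em : (((51 / 10 : ℚ)) : ℝ) = 51 / 10 := by norm_num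
  have h := window_lt_of_windowCheckSpin wtboxX slL19_nodup slL19_deg phatboxXs4_eq
    (fun b J hb hE => hR b J hb (by exact_mod_cast hE)) windowCheckSpin4_B19 (Δ := Δ)
    (by push_cast; linarith) (by push_cast; linarith)
  rwa [em] at h

end Summit.CriticalPhenomena.Ising3D.Control2D
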